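import Summits.KontsevichZagierPeriods.KontsevichZagierPeriods.Theses.AbelContraction
import Literature.NumberTheory.Transcendental.KZVolumeConjectureProofs
import Summits.KontsevichZagierPeriods.KontsevichZagierPeriods.Theorems.VietaFibreKernelFormStubBoundedDecomposition

/-!
# KontsevichZagierPeriods / AbelContraction — crux `RealArcKernel` (stmt-KontsevichZagierPeriods-12472),
# line `dimtwo_redirect`, sub-stub `stub_solids` of `stub_kzDimTwo` (= item stmt-4280, whose
# registered line `bounded_solids` has exactly this stub, with `IsBoundedVolume` unfolded)

A representation of dimension `≤ 2` is KZ-equivalent to a difference of two BOUNDED volume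
representations of dimension `3`: `KZ.exists_sub_isBounded` in dimension `n + 1`, then unit slabs up
to dimension `3` (`KZ.IntegralRep.slab`, `equivalent_slab`, `slab_integrand_eq_one`; slabs of bounded
domains are bounded — the landed `isBounded_slabDomain` / `exists_isBounded_lift_of_le` of
`Theorems/VietaFibreKernelFormStubBoundedDecomposition.lean` are reused, not restated).

Source: M. Kontsevich, D. Zagier, *Periods* (2001), §1.2; J. Viu-Sos (2021), Cor. 2.3.
-/

noncomputable section

open Literature.NumberTheory.Transcendental
open Summit.KontsevichZagierPeriods.KernelForm.LocaliseAtValuePrime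
  (exists_isBounded_lift_of_le)

namespace Summit.KontsevichZagierPeriods.AbelContraction.RealArcKernelStubSolids

/-- **Bounded solids** (sub-stub `stub_solids` of line `dimtwo_redirect` / line `bounded_solids` of
stmt-4280): a representation of dimension `≤ 2` is KZ-equivalent to `[s] − [s′]` with `s, s′` bounded
volume representations of dimension `3`. [cite: KontsevichZagier2001, §1.2] -/
theorem stub_solids : ∀ ⦃n : ℕ⦄, n ≤ 2 → ∀ (r : KZ.IntegralRep n), ∃ (s s' : KZ.IntegralRep 3), (Bornology.IsBounded s.domain ∧ ∀ z ∈ s.domain, s.integrand z = 1) ∧ (Bornology.IsBounded s'.domain ∧ ∀ z ∈ s'.domain, s'.integrand z = 1) ∧ KZ.of r - (KZ.of s - KZ.of s') ∈ KZ.relations := by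
  intro n hn r
  -- `[r] ≡ [A] − [B]` with `A`, `B` bounded volumes of dimension `n + 1` (Viu-Sos Cor. 2.3)
  obtain ⟨A, B, hAb, hBb, hA1, hB1, e⟩ := KZ.exists_sub_isBounded r
  -- raise both to dimension `3 = 2 + 1` by unit slabs (slabs of bounded sets are bounded)
  obtain ⟨s, hsb, hs1, es⟩ := exists_isBounded_lift_of_le hn A hAb hA1
  obtain ⟨s', hs'b, hs'1, es'⟩ := exists_isBounded_lift_of_le hn B hBb hB1
  refine ⟨s, s', ⟨hsb, hs1⟩, ⟨hs'b, hs'1⟩, ?_⟩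
  have : KZ.of r - (KZ.of s - KZ.of s') =
      (KZ.of r - (KZ.of A - KZ.of B)) + (KZ.of A - KZ.of s) - (KZ.of B - KZ.of s') := by
    abel
  rw [this]
  exact KZ.relations.sub_mem (KZ.relations.add_mem e es) es'

end Summit.KontsevichZagierPeriods.AbelContraction.RealArcKernelStubSolids

end
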